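import Summits.ResolutionOfSingularities.ResolutionOfSingularities.Theorems.EquisingularLiftEquisingularLiftNatInCarrierStepRegular
import Summits.ResolutionOfSingularities.ResolutionOfSingularities.Theorems.EquisingularLiftEquisingularLiftNatStrictTransformOffCentre
import Summits.ResolutionOfSingularities.ResolutionOfSingularities.Theorems.EquisingularLiftEquisingularLiftNatAdaptedFrame
import Summits.ResolutionOfSingularities.ResolutionOfSingularities.Theorems.EquisingularLiftEquisingularLiftNatCodimTwoOrderOne
import Summits.ResolutionOfSingularities.ResolutionOfSingularities.Theorems.EquisingularLiftEquisingularLiftNatConePackDegreeOne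
import Summits.ResolutionOfSingularities.ResolutionOfSingularities.Theorems.EquisingularLiftEquisingularLiftNatCarrierDeltaFrameAdapted
import Summits.ResolutionOfSingularities.ResolutionOfSingularities.Theorems.EquisingularLiftEquisingularLiftNatCarrierDeltaSectionFrameDim
import Summits.ResolutionOfSingularities.ResolutionOfSingularities.Theorems.EquisingularLiftEquisingularLiftNatInCarrierStepFlatRing
import Summits.ResolutionOfSingularities.ResolutionOfSingularities.Theorems.EquisingularLiftEquisingularLiftNatStalkDimension
import Summits.ResolutionOfSingularities.ResolutionOfSingularities.Theorems.EquisingularLiftEquisingularLiftSectionKer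
import Literature.AlgebraicGeometry.Resolution.MarkedIdealsArithmetic
import Literature.AlgebraicGeometry.Resolution.StrictTransformBaseChange
import Literature.AlgebraicGeometry.Resolution.CanonicalResolutionSmoothCentre
import HarnessLib

/-!
# [OURS · L1 W4.5(b) · EL♮(3)] HSUB(ReachTC⁺)₃ assembly (A), part 1 — the ADAPTED ORDER-ONE CONE PACK at a regular point of the
# running curve, and clause (v) of `TCPlus.Member` for the strict-transform pair (registered stub `stub_elnat_tcPlusPointResolution`;
# driver `hsub_reachTCPlus_of_invariant` p526242, brick (A) `member_strictTransform_of_regularPoint` of res-L1-w45b-stub-1's recipe)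

Crux `EquisingularLiftNat` = stmt-ResolutionOfSingularities-20038 (child EL♮(3) = stmt-ResolutionOfSingularities-20148), route EquisingularLift,
line `sections`. Helper file `--supports stmt-ResolutionOfSingularities-20148 --as helper` by res-L1-w45b-stub-4 (plan-1 RULING 2026-08-27T14:38:30Z
(R-B): stub-4 takes (A) of stub-1's recipe `L/res-L1-w45b-stub-1/NOTES.md` l.12). HONEST FRAMING: OURS (cell res-hironaka, slot W4.5(b)); NOT a
statement of any manuscript; AI-written, weaker than expert review. No `sorry`; standard axioms.

WHAT (assembly of landed bricks only).
* `eval_eq_of_isHomogeneous_one`, `span_range_le_of_isUnit_coeff` — a linear form in two variables with a unit coefficient: `Φ(x) = a x₀ + b x₁` and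
  `(x₀, x₁) ≤ (Φ(x)) + (x_{l'})` for the other index `l'`.
* **`exists_adaptedConePack`** — at the `O`-point `p = s(s₀)` of a stage `σ ≫ q : X → Spec O` (separated), with `𝒪_{X,p}` regular of dimension
  `3 + 1`, for an in-carrier pair `(𝓢, K)` on the section (`𝓢 ⊔ K ≤ ker s`) with principal stalks at `p` and `𝒪_{X,p} ⧸ (𝓢 ⊔ K)_p` REGULAR OF
  CODIMENSION TWO (clause (v) of `TCPlus.Member`): a frame `c = (h, c₁, c₂)` of `(ker s)_p` (quasi-regular, `𝒪/(c) ≅ O` a domain, tail quasi-regular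
  mod `h`, `(c) + (ϖ_R) = 𝔪`) with `𝓢_p = (h)`, a LINEAR form `Φ` with a unit coefficient and `K_p = (Φ(c₁, c₂))` (`Φ mod (c) ≠ 0`, `Φ mod 𝔪 ≠ 0`),
  and a tail element `g ∈ (ker s)_p ∖ (𝓢 ⊔ K)_p` with `(ker s)_p ≤ (𝓢 ⊔ K)_p + (g)` — res-type-100's section frame (`exists_sectionFrame_forall_dim_at`,
  `exists_sectionFrame_of_span_eq_forall_at`), res-L1-w45b-stub-1's `notMem_sq_of_isRegularLocalRing_quotient_codim_two` (p531429) and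
  `exists_adaptedFrame` (p536607), res-L1-w45b-stub-2's `isQuasiRegular_tail_of_sup_span_singleton_eq`, stub-1's `map_ne_zero_of_isUnit_coeff` (p529089);
  `g ∉ (𝓢 ⊔ K)_p` because `𝒪/(ker s)_p ≅ O` has dimension `1 ≠ 2`. Also `𝓢 ≠ ⊥`.
* **`member_clause_v_carrierStrictTransform`** — clause (v) of `TCPlus.Member` for the strict-transform pair `(St 𝓢, St K)` under the blow-up `τ` of
  `ker s`: at the special points over `p` by stub-1's `isRegularLocalRing_quotient_carrierStrictTransform_of_regularPoint` (p537715) with the pack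
  above, at the special points off the centre by stub-1's `isRegularLocalRing_quotient_carrierStrictTransform_of_not_mem_support` (p538787) from the
  old clause (v); the codimension by `ringKrullDim_stalk_eq_of_isBlowup_of_isClosed` (…NatStalkDimension; universal catenarity over the DVR). The excluded
  sets are abstract (`EX ⊆ X`, `EX₂ ⊆ X'` with `τ z ∈ EX ⇒ z ∈ EX₂` off the centre).

References: [cite: Matsumura1987, Thm. 14.2, Thm. 17.4]; [cite: GortzWedhorn2020, Prop. 13.91]; the cited tree files.
-/

set_option linter.dupNamespace false -- mandated namespace `Summit.<Summit>.<Problem>` of this single-conjunct summit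
set_option linter.overlappingInstances false -- signatures carry `[IsDomain O] [IsDiscreteValuationRing O]`

noncomputable section

open CategoryTheory CategoryTheory.Limits AlgebraicGeometry TopologicalSpace Topology IsLocalRing
open Literature.AlgebraicGeometry.Resolution
open AlgebraicGeometry.Scheme.IdealSheafData
open Summit.ResolutionOfSingularities.ResolutionOfSingularities.Cruxes.EquisingularLift.StrataSplit

namespace Summit.ResolutionOfSingularities.ResolutionOfSingularities.Cruxes.EquisingularLiftNat.Sections

universe u

/-! ## Linear forms in two variables -/

/-- A form of degree one in two variables is `a T₀ + b T₁` with `a, b` its coefficients. [folklore] -/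
theorem eq_C_mul_X_add_of_isHomogeneous_one {R : Type u} [CommRing R] (Φ : MvPolynomial (Fin 2) R) (hΦ : Φ.IsHomogeneous 1) :
    Φ = MvPolynomial.C (Φ.coeff (Finsupp.single 0 1)) * MvPolynomial.X 0 +
      MvPolynomial.C (Φ.coeff (Finsupp.single 1 1)) * MvPolynomial.X 1 := by
  classical
  have key : ∀ d ∈ Φ.support, d = Finsupp.single 0 1 ∨ d = Finsupp.single 1 1 := by
    intro d hd
    have h := hΦ.degree_eq_sum_deg_support hd
    have hsum : ∑ i ∈ d.support, d i = d 0 + d 1 := by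
      rw [Finset.sum_subset (Finset.subset_univ d.support) (fun i _ hi => Finsupp.notMem_support_iff.mp hi), Fin.sum_univ_two]
    rw [hsum] at h
    rcases Nat.eq_zero_or_pos (d 0) with h0 | h0
    · right
      ext i
      fin_cases i
      · show d 0 = Finsupp.single (1 : Fin 2) 1 0
        rw [Finsupp.single_apply, if_neg (by decide)]; exact h0
      · show d 1 = Finsupp.single (1 : Fin 2) 1 1
        rw [Finsupp.single_apply, if_pos rfl]; omega
    · left
      ext i
      fin_cases i
      · show d 0 = Finsupp.single (0 : Fin 2) 1 0
        rw [Finsupp.single_apply, if_pos rfl]; omega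
      · show d 1 = Finsupp.single (0 : Fin 2) 1 1
        rw [Finsupp.single_apply, if_neg (by decide)]; omega
  ext m
  simp only [MvPolynomial.coeff_add, MvPolynomial.coeff_C_mul, MvPolynomial.coeff_X, mul_ite, mul_one, mul_zero]
  by_cases h0 : m = Finsupp.single 0 1
  · subst h0
    have hne : ¬ (Finsupp.single (1 : Fin 2) 1 = Finsupp.single 0 1) := by
      rw [Finsupp.single_eq_single_iff]; simp
    rw [if_pos rfl, if_neg hne, add_zero]
  by_cases h1 : m = Finsupp.single 1 1
  · subst h1
    have hne : ¬ (Finsupp.single (0 : Fin 2) 1 = Finsupp.single 1 1) := by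
      rw [Finsupp.single_eq_single_iff]; simp
    rw [if_neg hne, if_pos rfl, zero_add]
  have hm : m ∉ Φ.support := fun hm => by
    rcases key m hm with h | h
    · exact h0 h
    · exact h1 h
  rw [MvPolynomial.notMem_support_iff.mp hm, if_neg (Ne.symm h0), if_neg (Ne.symm h1), add_zero]

/-- `Φ(x) = a x₀ + b x₁` for a form of degree one in two variables. [folklore] -/
theorem eval_eq_of_isHomogeneous_one {R : Type u} [CommRing R] (Φ : MvPolynomial (Fin 2) R) (hΦ : Φ.IsHomogeneous 1)
    (x : Fin 2 → R) :
    MvPolynomial.eval x Φ = Φ.coeff (Finsupp.single 0 1) * x 0 + Φ.coeff (Finsupp.single 1 1) * x 1 := by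
  conv_lhs => rw [eq_C_mul_X_add_of_isHomogeneous_one Φ hΦ]
  simp only [map_add, map_mul, MvPolynomial.eval_C, MvPolynomial.eval_X]

/-- For a linear form `Φ` in two variables whose coefficient at `l` is a unit and `x : Fin 2 → R`: the other variable `x_{l'}` together with
`Φ(x)` generates `(x₀, x₁)`. [folklore] -/
theorem exists_span_range_le_of_isUnit_coeff {R : Type u} [CommRing R] (Φ : MvPolynomial (Fin 2) R) (hΦ : Φ.IsHomogeneous 1)
    {l : Fin 2} (hu : IsUnit (Φ.coeff (Finsupp.single l 1))) (x : Fin 2 → R) :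
    ∃ l' : Fin 2, Ideal.span (Set.range x) ≤ Ideal.span {MvPolynomial.eval x Φ} ⊔ Ideal.span {x l'} := by
  have hev := eval_eq_of_isHomogeneous_one Φ hΦ x
  obtain ⟨u, hu'⟩ := hu
  have hinv : (↑u⁻¹ : R) * ↑u = 1 := u.inv_mul
  fin_cases l
  · -- `Φ(x) = a x₀ + b x₁`, `a` a unit: `x₀ = a⁻¹ (Φ(x) - b x₁)`
    simp only [Fin.zero_eta, Fin.isValue] at hu'
    refine ⟨1, Ideal.span_le.mpr ?_⟩
    rintro _ ⟨i, rfl⟩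
    fin_cases i
    · show x 0 ∈ _
      have e : x 0 = ↑u⁻¹ * MvPolynomial.eval x Φ + (-(↑u⁻¹ * Φ.coeff (Finsupp.single 1 1))) * x 1 := by
        rw [hev, ← hu']
        linear_combination (-(x 0)) * hinv
      rw [e]
      exact Ideal.add_mem _ (Ideal.mem_sup_left (Ideal.mem_span_singleton'.mpr ⟨_, rfl⟩))
        (Ideal.mem_sup_right (Ideal.mem_span_singleton'.mpr ⟨_, rfl⟩))
    · show x 1 ∈ _
      exact Ideal.mem_sup_right (Ideal.mem_span_singleton_self _)
  · simp only [Fin.mk_one, Fin.isValue] at hu'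
    refine ⟨0, Ideal.span_le.mpr ?_⟩
    rintro _ ⟨i, rfl⟩
    fin_cases i
    · show x 0 ∈ _
      exact Ideal.mem_sup_right (Ideal.mem_span_singleton_self _)
    · show x 1 ∈ _
      have e : x 1 = ↑u⁻¹ * MvPolynomial.eval x Φ + (-(↑u⁻¹ * Φ.coeff (Finsupp.single 0 1))) * x 0 := by
        rw [hev, ← hu']
        linear_combination (-(x 1)) * hinv
      rw [e]
      exact Ideal.add_mem _ (Ideal.mem_sup_left (Ideal.mem_span_singleton'.mpr ⟨_, rfl⟩))
        (Ideal.mem_sup_right (Ideal.mem_span_singleton'.mpr ⟨_, rfl⟩))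

/-! ## The adapted order-one cone pack at a regular point of the running curve -/

section Pack

variable (O : Type) [CommRing O] [IsDomain O] [IsDiscreteValuationRing O]

/-- **The adapted order-one cone pack.** At the `O`-point `p = s(s₀)` of a section `s` of the separated `σ ≫ q : X → Spec O`, with `𝒪_{X,p}`
regular of dimension `3 + 1`, let `(𝓢, K)` be an in-carrier pair on the section (`𝓢 ⊔ K ≤ ker s`) with principal stalks at `p`, `p ∈ supp (𝓢 ⊔ K)`, and
`𝒪_{X,p} ⧸ (𝓢 ⊔ K)_p` regular of codimension two. THEN there are a frame `c : Fin 3 → 𝒪_{X,p}` of `(ker s)_p` — quasi-regular, `𝒪/(c)` a domain, tail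
quasi-regular modulo `c₀`, `(c) + (ϖ_R) = 𝔪` — with `𝓢_p = (c₀)`, a LINEAR form `Φ` with `K_p = (Φ(c₁, c₂))`, `Φ mod (c) ≠ 0`, `Φ mod 𝔪 ≠ 0`, and
`g ∈ (ker s)_p ∖ (𝓢 ⊔ K)_p` with `(ker s)_p ≤ (𝓢 ⊔ K)_p + (g)`; and `𝓢 ≠ ⊥`. [cite: Matsumura1987, Thm. 14.2] [OURS · L1 W4.5b] -/
theorem exists_adaptedConePack {X P : Scheme.{0}} [IsIntegral X] [IsLocallyNoetherian X] (σ : X ⟶ P) (q : P ⟶ Spec (.of O))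
    [IsSeparated (σ ≫ q)] (s : Spec (.of O) ⟶ X) (hs : s ≫ σ ≫ q = 𝟙 _) {p : X} (hp : s (closedPoint O) = p)
    (hreg : IsRegularLocalRing (X.presheaf.stalk p)) (hdim : ringKrullDim (X.presheaf.stalk p) = (3 + 1 : ℕ))
    (ϖ : O) (hϖ : Irreducible ϖ) (𝓢 K : X.IdealSheafData) (hle : 𝓢 ⊔ K ≤ s.ker)
    (h𝓢p : (stalkIdeal 𝓢 p).IsPrincipal) (hKp : (stalkIdeal K p).IsPrincipal)
    (hDreg : IsRegularLocalRing (X.presheaf.stalk p ⧸ stalkIdeal (𝓢 ⊔ K) p))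
    (hDdim : ringKrullDim (X.presheaf.stalk p ⧸ stalkIdeal (𝓢 ⊔ K) p) + 2 = ringKrullDim (X.presheaf.stalk p)) :
    ∃ (c : Fin 3 → X.presheaf.stalk p) (Φ : MvPolynomial (Fin 2) (X.presheaf.stalk p)) (g : X.presheaf.stalk p),
      Ideal.span (Set.range c) = stalkIdeal s.ker p ∧ IsQuasiRegular c ∧
      IsDomain (X.presheaf.stalk p ⧸ Ideal.span (Set.range c)) ∧
      IsQuasiRegular (fun l : Fin 2 => Ideal.Quotient.mk (Ideal.span {c 0}) (c l.succ)) ∧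
      Ideal.span (Set.range c) ⊔ Ideal.span {(X.presheaf.Γgerm p).hom ((σ ≫ q).appTop.hom ((Scheme.ΓSpecIso (.of O)).inv.hom ϖ))} =
        maximalIdeal (X.presheaf.stalk p) ∧
      stalkIdeal 𝓢 p = Ideal.span {c 0} ∧ Φ.IsHomogeneous 1 ∧
      stalkIdeal K p = Ideal.span {MvPolynomial.eval (fun l : Fin 2 => c l.succ) Φ} ∧
      MvPolynomial.map (Ideal.Quotient.mk (Ideal.span (Set.range c))) Φ ≠ 0 ∧
      MvPolynomial.map (IsLocalRing.residue (X.presheaf.stalk p)) Φ ≠ 0 ∧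
      g ∈ stalkIdeal s.ker p ∧ g ∉ stalkIdeal (𝓢 ⊔ K) p ∧ stalkIdeal s.ker p ≤ stalkIdeal (𝓢 ⊔ K) p ⊔ Ideal.span {g} ∧
      𝓢 ≠ ⊥ := by
  classical
  subst hp
  haveI := hreg
  -- (1) a section frame; the number of coordinates is `3`
  obtain ⟨n, c₀, θ₀, hc₀I, -, hdom₀, -, h𝔪₀, -, hdim₀⟩ := exists_sectionFrame_forall_dim_at O (σ ≫ q) s hs _ rfl hreg ϖ hϖ
  have hn : n = 3 := by
    rw [hdim] at hdim₀
    have h' : ((3 + 1 : ℕ) : WithBot ℕ∞) = ((n + 1 : ℕ) : WithBot ℕ∞) := hdim₀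
    have h'' : (3 + 1 : ℕ) = n + 1 := by exact_mod_cast h'
    omega
  subst hn
  have hI𝔪 : Ideal.span (Set.range c₀) ≤ maximalIdeal _ := le_sup_left.trans h𝔪₀.le
  have hc₀𝔪 : ∀ i, c₀ i ∈ maximalIdeal _ := fun i => hI𝔪 (Ideal.subset_span ⟨i, rfl⟩)
  -- (2) local equations `h`, `f`
  obtain ⟨h, hh⟩ := h𝓢p.principal
  obtain ⟨f, hf⟩ := hKp.principal
  change stalkIdeal 𝓢 _ = Ideal.span {h} at hh
  change stalkIdeal K _ = Ideal.span {f} at hf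
  have hsum : stalkIdeal (𝓢 ⊔ K) (s (closedPoint O)) = Ideal.span {h} ⊔ Ideal.span {f} := by rw [stalkIdeal_sup, hh, hf]
  have h𝓢le : stalkIdeal 𝓢 (s (closedPoint O)) ≤ Ideal.span (Set.range c₀) :=
    hc₀I ▸ stalkIdeal_mono (le_sup_left.trans hle) _
  have hKle : stalkIdeal K (s (closedPoint O)) ≤ Ideal.span (Set.range c₀) :=
    hc₀I ▸ stalkIdeal_mono (le_sup_right.trans hle) _
  have hhc : h ∈ Ideal.span (Set.range c₀) := h𝓢le (hh ▸ Ideal.mem_span_singleton_self h)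
  have hfc : f ∈ Ideal.span (Set.range c₀) := hKle (hf ▸ Ideal.mem_span_singleton_self f)
  have hhm : h ∈ maximalIdeal _ := hI𝔪 hhc
  have hfm : f ∈ maximalIdeal _ := hI𝔪 hfc
  -- (3) codimension two forces order one
  haveI : IsRegularLocalRing (X.presheaf.stalk (s (closedPoint O)) ⧸ (Ideal.span {h} ⊔ Ideal.span {f})) := by
    rw [← hsum]; exact hDreg
  have hdim' : ringKrullDim (X.presheaf.stalk (s (closedPoint O)) ⧸ (Ideal.span {h} ⊔ Ideal.span {f})) + 2 =
      ringKrullDim (X.presheaf.stalk (s (closedPoint O))) := by rw [← hsum]; exact hDdim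
  obtain ⟨hh2, hf2⟩ := notMem_sq_of_isRegularLocalRing_quotient_codim_two hhm hfm hdim'
  -- (4) the adapted frame and its section-frame facts
  obtain ⟨c, Φ, hcc₀, hc0, hΦ1, heval, l, hunit⟩ := exists_adaptedFrame c₀ hc₀𝔪 hhc hfc hh2 hf2
  have hcI : Ideal.span (Set.range c) = stalkIdeal s.ker (s (closedPoint O)) := hcc₀.trans hc₀I
  obtain ⟨θc, hcq, hcdom, -, h𝔪c, -⟩ := exists_sectionFrame_of_span_eq_forall_at O (σ ≫ q) s hs _ rfl hreg ϖ hϖ c hcI hdim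
  haveI := hcdom
  have hcb : IsQuasiRegular (fun l : Fin 2 => Ideal.Quotient.mk (Ideal.span {c 0}) (c l.succ)) :=
    isQuasiRegular_tail_of_sup_span_singleton_eq c _ h𝔪c hdim
  have hΦ𝔪 : MvPolynomial.map (IsLocalRing.residue (X.presheaf.stalk (s (closedPoint O)))) Φ ≠ 0 :=
    map_ne_zero_of_isUnit_coeff _ hunit
  have hΦc : MvPolynomial.map (Ideal.Quotient.mk (Ideal.span (Set.range c))) Φ ≠ 0 := map_ne_zero_of_isUnit_coeff _ hunit
  have h𝓢c : stalkIdeal 𝓢 (s (closedPoint O)) = Ideal.span {c 0} := by rw [hc0]; exact hh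
  have hKc : stalkIdeal K (s (closedPoint O)) = Ideal.span {MvPolynomial.eval (fun l : Fin 2 => c l.succ) Φ} := by
    rw [heval]; exact hf
  -- (5) the tail element `g` not carrying the unit coefficient
  obtain ⟨l', hl'⟩ := exists_span_range_le_of_isUnit_coeff Φ hΦ1 hunit (fun l : Fin 2 => c l.succ)
  have hJ : stalkIdeal (𝓢 ⊔ K) (s (closedPoint O)) = Ideal.span {c 0} ⊔ Ideal.span {MvPolynomial.eval (fun l : Fin 2 => c l.succ) Φ} := by
    rw [stalkIdeal_sup, h𝓢c, hKc]
  have hgC : c l'.succ ∈ stalkIdeal s.ker (s (closedPoint O)) := hcI ▸ Ideal.subset_span ⟨l'.succ, rfl⟩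
  have hCg : stalkIdeal s.ker (s (closedPoint O)) ≤ stalkIdeal (𝓢 ⊔ K) (s (closedPoint O)) ⊔ Ideal.span {c l'.succ} := by
    rw [← hcI, hJ, Ideal.span_le]
    rintro _ ⟨i, rfl⟩
    refine Fin.cases ?_ (fun l => ?_) i
    · exact Ideal.mem_sup_left (Ideal.mem_sup_left (Ideal.mem_span_singleton_self _))
    · have h1 : c l.succ ∈ Ideal.span (Set.range fun l : Fin 2 => c l.succ) := Ideal.subset_span ⟨l, rfl⟩
      have h2 := hl' h1
      rw [sup_assoc]
      exact Ideal.mem_sup_right h2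
  have hJle : stalkIdeal (𝓢 ⊔ K) (s (closedPoint O)) ≤ stalkIdeal s.ker (s (closedPoint O)) := stalkIdeal_mono hle _
  have hg0 : c l'.succ ∉ stalkIdeal (𝓢 ⊔ K) (s (closedPoint O)) := by
    intro hg
    -- then `(𝓢 ⊔ K)_p = (ker s)_p`, of codimension `1`, not `2`
    have heq : stalkIdeal (𝓢 ⊔ K) (s (closedPoint O)) = Ideal.span (Set.range c) := by
      rw [hcI]
      refine le_antisymm hJle (hCg.trans (sup_le le_rfl ((Ideal.span_singleton_le_iff_mem _).mpr hg)))
    have h1 : ringKrullDim (X.presheaf.stalk (s (closedPoint O)) ⧸ Ideal.span (Set.range c)) = 1 := by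
      rw [ringKrullDim_eq_of_ringEquiv θc]; exact IsDiscreteValuationRing.ringKrullDim_eq_one O
    rw [heq, h1, hdim] at hDdim
    have h2 : ((1 : ℕ) : WithBot ℕ∞) + 2 = ((3 + 1 : ℕ) : WithBot ℕ∞) := by exact_mod_cast hDdim
    have h3 : (1 : ℕ) + 2 = 3 + 1 := by exact_mod_cast h2
    omega
  have h𝓢0 : 𝓢 ≠ ⊥ := by
    rintro rfl
    rw [stalkIdeal_bot] at hh
    have : h = 0 := by
      have := hh ▸ (Submodule.mem_bot _).mpr rfl
      simpa [Ideal.mem_span_singleton] using (Ideal.span_singleton_eq_bot.mp hh.symm)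
    exact hh2 (this ▸ Ideal.zero_mem _)
  exact ⟨c, Φ, c l'.succ, hcI, hcq, hcdom, hcb, h𝔪c, h𝓢c, hΦ1, hKc, hΦc, hΦ𝔪, hgC, hg0, hCg, h𝓢0⟩

/-! ## Clause (v) of `TCPlus.Member` for the strict-transform pair -/

/-- **Clause (v) after an in-carrier point step at a regular point of the running curve.** In the setting of `exists_adaptedConePack` (its
output as hypotheses), let `τ : X' → X` be the blow-up of `ker s`, and let the old pair satisfy clause (v) at the special points of
`supp (𝓢 ⊔ K)` outside a set `EX`; let `EX₂ ⊆ X'` contain every point off the centre whose image lies in `EX`. THEN the strict-transform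
pair `(St 𝓢, St K)` satisfies clause (v) at the special points of its support outside `EX₂`: regular quotient stalks (stub-1's p537715 over `p`,
p538787 off the centre) of codimension two at the closed ones (`dim 𝒪_{X',z} = dim 𝒪_{X,τ z}` at closed `z`, …NatStalkDimension).
[cite: GortzWedhorn2020, Prop. 13.91; Matsumura1987, Thm. 17.4] [OURS · L1 W4.5b] -/
theorem member_clause_v_carrierStrictTransform {X X' P : Scheme.{0}} [IsIntegral X] [IsLocallyNoetherian X] [IsLocallyNoetherian X']
    (σ : X ⟶ P) (q : P ⟶ Spec (.of O)) [IsSeparated (σ ≫ q)] [LocallyOfFiniteType (σ ≫ q)]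
    (s : Spec (.of O) ⟶ X) (hs : s ≫ σ ≫ q = 𝟙 _) {τ : X' ⟶ X} (hτ : IsBlowup τ s.ker) (𝓢 K : X.IdealSheafData)
    (c : Fin 3 → X.presheaf.stalk (s (closedPoint O))) (hcJ : Ideal.span (Set.range c) = stalkIdeal s.ker (s (closedPoint O)))
    (hc : IsQuasiRegular c) [IsDomain (X.presheaf.stalk (s (closedPoint O)) ⧸ Ideal.span (Set.range c))]
    (hcb : IsQuasiRegular fun l : Fin 2 => Ideal.Quotient.mk (Ideal.span {c 0}) (c l.succ))
    (h𝓢 : stalkIdeal 𝓢 (s (closedPoint O)) = Ideal.span {c 0}) (Φ : MvPolynomial (Fin 2) (X.presheaf.stalk (s (closedPoint O))))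
    (hΦd : Φ.IsHomogeneous 1) (hΦ : MvPolynomial.map (Ideal.Quotient.mk (Ideal.span (Set.range c))) Φ ≠ 0)
    (hK : stalkIdeal K (s (closedPoint O)) = Ideal.span {MvPolynomial.eval (fun l => c l.succ) Φ})
    (hDreg : IsRegularLocalRing (X.presheaf.stalk (s (closedPoint O)) ⧸ stalkIdeal (𝓢 ⊔ K) (s (closedPoint O))))
    (hDdim : ringKrullDim (X.presheaf.stalk (s (closedPoint O)) ⧸ stalkIdeal (𝓢 ⊔ K) (s (closedPoint O))) + 2 =
      ringKrullDim (X.presheaf.stalk (s (closedPoint O))))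
    (g : X.presheaf.stalk (s (closedPoint O))) (hgC : g ∈ stalkIdeal s.ker (s (closedPoint O)))
    (hg0 : g ∉ stalkIdeal (𝓢 ⊔ K) (s (closedPoint O)))
    (hCg : stalkIdeal s.ker (s (closedPoint O)) ≤ stalkIdeal (𝓢 ⊔ K) (s (closedPoint O)) ⊔ Ideal.span {g})
    (EX : Set X) (EX₂ : Set X') (hEX : ∀ z : X', τ z ∉ (s.ker.support : Set X) → τ z ∈ EX → z ∈ EX₂)
    (hvX : ∀ x ∈ ((𝓢 ⊔ K).support : Set X), (σ ≫ q) x = closedPoint O → x ∉ EX →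
      IsRegularLocalRing (X.presheaf.stalk x ⧸ stalkIdeal (𝓢 ⊔ K) x) ∧
      (IsClosed ({x} : Set X) → ringKrullDim (X.presheaf.stalk x ⧸ stalkIdeal (𝓢 ⊔ K) x) + 2 = ringKrullDim (X.presheaf.stalk x))) :
    ∀ z ∈ ((strictTransformIdeal τ s.ker 𝓢 ⊔ strictTransformIdeal τ s.ker K).support : Set X'),
      ((τ ≫ σ) ≫ q) z = closedPoint O → z ∉ EX₂ →
      IsRegularLocalRing (X'.presheaf.stalk z ⧸ stalkIdeal (strictTransformIdeal τ s.ker 𝓢 ⊔ strictTransformIdeal τ s.ker K) z) ∧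
      (IsClosed ({z} : Set X') →
        ringKrullDim (X'.presheaf.stalk z ⧸ stalkIdeal (strictTransformIdeal τ s.ker 𝓢 ⊔ strictTransformIdeal τ s.ker K) z) + 2 =
          ringKrullDim (X'.presheaf.stalk z)) := by
  intro z hz hzs hzEX
  haveI : IsProper τ := hτ.isProper
  have hUC : IsUniversallyCatenaryRing (X.presheaf.stalk (τ z)) :=
    isUniversallyCatenaryRing_stalk_of_locallyOfFiniteType (isUniversallyCatenaryRing_of_isDiscreteValuationRing O) (σ ≫ q) (τ z)
  have hdimz : IsClosed ({z} : Set X') → ringKrullDim (X'.presheaf.stalk z) = ringKrullDim (X.presheaf.stalk (τ z)) :=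
    fun hzcl => ringKrullDim_stalk_eq_of_isBlowup_of_isClosed hτ hzcl hUC
  obtain ⟨_, -, -, hCsupp⟩ := section_isClosedImmersion_and_isRegular_ker O X (σ ≫ q) s hs
  have hp : s (closedPoint O) ∈ (s.ker.support : Set X) := by rw [hCsupp]; exact ⟨_, rfl⟩
  by_cases hzc : τ z ∈ (s.ker.support : Set X)
  · -- over the centre: `τ z = s(s₀)`
    have hzp : τ z = s (closedPoint O) := by
      rw [hCsupp] at hzc
      obtain ⟨u, hu⟩ := hzc
      have hu' : u = closedPoint O := by
        have h1 : (σ ≫ q) (s u) = u := by rw [← Scheme.Hom.comp_apply, hs]; rfl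
        rw [hu] at h1
        rw [← h1]
        simpa only [Scheme.Hom.comp_apply] using hzs
      rw [← hu, hu']
    obtain ⟨hreg', hdimeq⟩ := isRegularLocalRing_quotient_carrierStrictTransform_of_regularPoint hτ 𝓢 K (s (closedPoint O)) hp c hcJ
      hc hcb h𝓢 Φ hΦd hΦ hK hDreg g hgC hg0 hCg z hzp hz
    refine ⟨hreg', fun hzcl => ?_⟩
    rw [hdimeq, hdimz hzcl, hzp]
    exact hDdim
  · -- off the centre: the old clause (v) at `τ z`, transported along the stalk isomorphism
    have hτz : τ z ∈ ((𝓢 ⊔ K).support : Set X) := by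
      have h1 : z ∈ (((𝓢 ⊔ K).comap τ).support : Set X') := by
        refine Scheme.IdealSheafData.support_antitone ?_ hz
        rw [Scheme.IdealSheafData.comap_sup]
        exact sup_le_sup (comap_le_strictTransformIdeal τ s.ker 𝓢) (comap_le_strictTransformIdeal τ s.ker K)
      rw [Scheme.IdealSheafData.support_comap] at h1
      exact h1
    have hτzs : (σ ≫ q) (τ z) = closedPoint O := by simpa only [Scheme.Hom.comp_apply] using hzs
    have hτzEX : τ z ∉ EX := fun h => hzEX (hEX z hzc h)
    obtain ⟨hregX, hcodX⟩ := hvX (τ z) hτz hτzs hτzEX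
    obtain ⟨hreg', hdimeq⟩ := isRegularLocalRing_quotient_carrierStrictTransform_of_not_mem_support hτ 𝓢 K hzc hregX
    refine ⟨hreg', fun hzcl => ?_⟩
    have hτzcl : IsClosed ({τ z} : Set X) := by
      have h1 := τ.isClosedMap _ hzcl
      rwa [Set.image_singleton] at h1
    rw [hdimeq, hdimz hzcl]
    exact hcodX hτzcl

end Pack

end Summit.ResolutionOfSingularities.ResolutionOfSingularities.Cruxes.EquisingularLiftNat.Sections

end
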